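import Literature.MathematicalPhysics.QuantumManyBody.PeriodicFeynmanKacTrialState
import Literature.MathematicalPhysics.QuantumManyBody.WeightedCorrector
import Literature.MathematicalPhysics.QuantumManyBody.BoseGasProductState
import HarnessLib

/-!
# Response dictionary, part S: symmetrising the test function of the `H₋₁` supremum

Support file for the registered stub `stub_responseDictionary` of line `healing-scale-kac-insertion`
(crux `BECInsertionCorrector.CorrectorClosure`, item stmt-AtomisticToContinuum-12058). The
Kipnis–Varadhan functional `β ↦ 2∫gβΘ₀² - ∫|∇β|²Θ₀²` of a permutation-SYMMETRIC weight `Θ₀` and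
observable `g` does not decrease under the Bose symmetrisation `β ↦ (N!)⁻¹∑_σ β(·∘σ)`: the pairing is
unchanged (relabelling preserves the cell and Lebesgue measure) and the Dirichlet form decreases
(convexity of `|·|²`, Cauchy–Schwarz over `σ`). Hence a bound on symmetric tests bounds `hMinusOneSqW`.
Supports (does not close) stmt-AtomisticToContinuum-12058, route `BECInsertionCorrector`.
-/

noncomputable section

open MeasureTheory Filter
open scoped ENNReal NNReal BigOperators Topology

namespace Summit.AtomisticToContinuum.BoseEinsteinCondensation.Theorems.CorrectorClosure.HealingScaleKacInsertion.ResponseDictionary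

open Literature.MathematicalPhysics.QuantumManyBody.BoseGas

variable {N : ℕ}

/-! ### Relabelling the particles -/

/-- Chain rule for the relabelling `X ↦ X ∘ σ` (the continuous linear map `relabelCLM σ` of
`BoseGasProductState`), real-valued functions. [folklore] -/
theorem hasFDerivAt_comp_perm {β : Config N → ℝ} {X : Config N} (σ : Equiv.Perm (Fin N))
    (hβ : DifferentiableAt ℝ β (X ∘ σ)) :
    HasFDerivAt (fun Y : Config N => β (Y ∘ σ)) ((fderiv ℝ β (X ∘ σ)).comp (relabelCLM σ)) X :=
  -- adapted from `kineticDensity_comp_perm` (BoseGasProductState)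
  hβ.hasFDerivAt.comp X (relabelCLM σ).hasFDerivAt

/-- `X ↦ β(X ∘ σ)` is `C¹` for `C¹` `β`. [folklore] -/
theorem contDiff_comp_perm_real {β : Config N → ℝ} (hβ : ContDiff ℝ 1 β) (σ : Equiv.Perm (Fin N)) :
    ContDiff ℝ 1 fun Y : Config N => β (Y ∘ σ) :=
  hβ.comp (relabelCLM σ).contDiff

/-- `∂_{i,k}(β(· ∘ σ))(X) = (∂_{σ⁻¹i,k}β)(X ∘ σ)`. [folklore] -/
theorem pderiv_comp_perm {β : Config N → ℝ} (hβ : Differentiable ℝ β) (σ : Equiv.Perm (Fin N))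
    (X : Config N) (i : Fin N) (k : Fin 3) :
    pderiv i k (fun Y => β (Y ∘ σ)) X = pderiv (σ.symm i) k β (X ∘ σ) := by
  unfold pderiv
  rw [(hasFDerivAt_comp_perm σ (hβ _)).fderiv, ContinuousLinearMap.comp_apply, relabelCLM_apply,
    single_comp_perm]

/-- `|∇(β(·∘σ))|²(X) = |∇β|²(X ∘ σ)`. [folklore] -/
theorem gradDot_comp_perm {β : Config N → ℝ} (hβ : Differentiable ℝ β) (σ : Equiv.Perm (Fin N))
    (X : Config N) :
    gradDot (fun Y => β (Y ∘ σ)) (fun Y => β (Y ∘ σ)) X = gradDot β β (X ∘ σ) := by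
  simp only [gradDot, pderiv_comp_perm hβ σ]
  exact Equiv.sum_comp σ.symm (fun i => ∑ k, pderiv i k β (X ∘ σ) * pderiv i k β (X ∘ σ))

/-- **Relabelling preserves cell integrals**: `∫_cell G(X ∘ σ) dX = ∫_cell G`. [folklore] -/
theorem setIntegral_cellN_comp_perm (L : ℝ) (σ : Equiv.Perm (Fin N)) (G : Config N → ℝ) :
    ∫ X in cellN N L, G (X ∘ σ) = ∫ X in cellN N L, G X := by
  have hmp := volume_measurePreserving_piCongrLeft (fun _ : Fin N => Space) σ.symm
  have happ : ∀ X : Config N,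
      (MeasurableEquiv.piCongrLeft (fun _ : Fin N => Space) σ.symm) X = X ∘ σ :=
    piCongrLeft_symm_apply σ
  have hpre : (MeasurableEquiv.piCongrLeft (fun _ : Fin N => Space) σ.symm) ⁻¹' (cellN N L) =
      cellN N L := by
    ext X
    simp only [Set.mem_preimage, happ, cellN, Set.mem_setOf_eq, Function.comp_apply]
    exact ⟨fun h i => by simpa using h (σ.symm i), fun h i => h (σ i)⟩
  have := hmp.setIntegral_preimage_emb
    (MeasurableEquiv.piCongrLeft (fun _ : Fin N => Space) σ.symm).measurableEmbedding G (cellN N L)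
  rw [hpre] at this
  simpa only [happ] using this

/-- `∂_{i,k}` of `c ∑_j f_j` is `c ∑_j ∂_{i,k} f_j` at points of differentiability. [folklore] -/
theorem pderiv_const_mul_sum {ι : Type*} (s : Finset ι) {f : ι → Config N → ℝ} {X : Config N}
    (hf : ∀ j ∈ s, DifferentiableAt ℝ (f j) X) (c : ℝ) (i : Fin N) (k : Fin 3) :
    pderiv i k (fun Y => c * ∑ j ∈ s, f j Y) X = c * ∑ j ∈ s, pderiv i k (f j) X := by
  unfold pderiv
  have h := (HasFDerivAt.fun_sum fun j hj => (hf j hj).hasFDerivAt).const_mul c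
  rw [h.fderiv]
  simp only [FunLike.coe_smul, Pi.smul_apply, smul_eq_mul, FunLike.coe_sum,
    Finset.sum_apply]

/-! ### The Bose symmetrisation of a test function -/

section Symmetrise

variable {L : ℝ}

/-- The symmetrisation `(N!)⁻¹ ∑_σ β(· ∘ σ)` of a periodic test function is a periodic test function.
[folklore] -/
theorem isPeriodicTest_symmetrise {β : Config N → ℝ} (hβ : IsPeriodicTest L β) :
    IsPeriodicTest L fun X => (Fintype.card (Equiv.Perm (Fin N)) : ℝ)⁻¹ *
      ∑ σ : Equiv.Perm (Fin N), β (X ∘ σ) := by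
  refine ⟨contDiff_const.mul (ContDiff.sum fun σ _ => contDiff_comp_perm_real hβ.1 σ), fun X i k => ?_⟩
  simp only
  congr 1
  refine Finset.sum_congr rfl fun σ _ => ?_
  have h : (X + Pi.single i (EuclideanSpace.single k L)) ∘ σ =
      X ∘ σ + Pi.single (σ.symm i) (EuclideanSpace.single k L) := by
    rw [← single_comp_perm σ i]; rfl
  rw [h, hβ.2]

/-- The symmetrisation is permutation symmetric. [folklore] -/
theorem symmetrise_comp_perm (β : Config N → ℝ) (τ : Equiv.Perm (Fin N)) (X : Config N) :
    (fun X => (Fintype.card (Equiv.Perm (Fin N)) : ℝ)⁻¹ * ∑ σ : Equiv.Perm (Fin N), β (X ∘ σ))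
        (X ∘ τ) =
      (fun X => (Fintype.card (Equiv.Perm (Fin N)) : ℝ)⁻¹ * ∑ σ : Equiv.Perm (Fin N), β (X ∘ σ))
        X := by
  simp only
  congr 1
  exact Equiv.sum_comp (Equiv.mulLeft τ) (fun σ : Equiv.Perm (Fin N) => β (X ∘ ⇑σ))

/-- **The pairing is invariant under symmetrisation** (for symmetric `Θ₀` and `g`). [folklore] -/
theorem integral_symmetrise_pairing {g Θ₀ β : Config N → ℝ}
    (hgsymm : ∀ (σ : Equiv.Perm (Fin N)) (X : Config N), g (X ∘ σ) = g X)
    (hΘsymm : ∀ (σ : Equiv.Perm (Fin N)) (X : Config N), Θ₀ (X ∘ σ) = Θ₀ X)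
    (hint : ∀ σ : Equiv.Perm (Fin N),
      IntegrableOn (fun X => Θ₀ X ^ 2 * (β (X ∘ σ) * g X)) (cellN N L)) :
    ∫ X in cellN N L, Θ₀ X ^ 2 * (((Fintype.card (Equiv.Perm (Fin N)) : ℝ)⁻¹ *
        ∑ σ : Equiv.Perm (Fin N), β (X ∘ σ)) * g X) =
      ∫ X in cellN N L, Θ₀ X ^ 2 * (β X * g X) := by
  have hcard : (Fintype.card (Equiv.Perm (Fin N)) : ℝ) ≠ 0 := by
    exact_mod_cast Fintype.card_ne_zero
  have hterm : ∀ σ : Equiv.Perm (Fin N),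
      ∫ X in cellN N L, Θ₀ X ^ 2 * (β (X ∘ σ) * g X) = ∫ X in cellN N L, Θ₀ X ^ 2 * (β X * g X) := by
    intro σ
    have h := setIntegral_cellN_comp_perm L σ (fun X => Θ₀ X ^ 2 * (β X * g X))
    simp only [hΘsymm, hgsymm] at h
    exact h
  calc ∫ X in cellN N L, Θ₀ X ^ 2 * (((Fintype.card (Equiv.Perm (Fin N)) : ℝ)⁻¹ *
          ∑ σ : Equiv.Perm (Fin N), β (X ∘ σ)) * g X)
      = ∫ X in cellN N L, (Fintype.card (Equiv.Perm (Fin N)) : ℝ)⁻¹ *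
          ∑ σ : Equiv.Perm (Fin N), Θ₀ X ^ 2 * (β (X ∘ σ) * g X) := by
        refine integral_congr_ae (ae_of_all _ fun X => ?_)
        simp only [Finset.mul_sum, Finset.sum_mul]
        exact Finset.sum_congr rfl fun σ _ => by ring
    _ = (Fintype.card (Equiv.Perm (Fin N)) : ℝ)⁻¹ *
          ∑ σ : Equiv.Perm (Fin N), ∫ X in cellN N L, Θ₀ X ^ 2 * (β (X ∘ σ) * g X) := by
        rw [integral_const_mul, integral_finsetSum _ fun σ _ => hint σ]
    _ = ∫ X in cellN N L, Θ₀ X ^ 2 * (β X * g X) := by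
        simp only [hterm, Finset.sum_const, Finset.card_univ, nsmul_eq_mul]
        rw [← mul_assoc, inv_mul_cancel₀ hcard, one_mul]

/-- **The weighted Dirichlet form decreases under symmetrisation** (symmetric continuous weight):
`∫Θ₀²|∇β_sym|² ≤ ∫Θ₀²|∇β|²`. [folklore] -/
theorem integral_symmetrise_dirichlet_le {Θ₀ β : Config N → ℝ} (hΘc : Continuous Θ₀)
    (hΘsymm : ∀ (σ : Equiv.Perm (Fin N)) (X : Config N), Θ₀ (X ∘ σ) = Θ₀ X)
    (hβ : ContDiff ℝ 1 β) :
    ∫ X in cellN N L, Θ₀ X ^ 2 *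
        gradDot (fun X => (Fintype.card (Equiv.Perm (Fin N)) : ℝ)⁻¹ *
            ∑ σ : Equiv.Perm (Fin N), β (X ∘ σ))
          (fun X => (Fintype.card (Equiv.Perm (Fin N)) : ℝ)⁻¹ *
            ∑ σ : Equiv.Perm (Fin N), β (X ∘ σ)) X ≤
      ∫ X in cellN N L, Θ₀ X ^ 2 * gradDot β β X := by
  set c : ℝ := (Fintype.card (Equiv.Perm (Fin N)) : ℝ)⁻¹ with hc
  have hcard : (0 : ℝ) < Fintype.card (Equiv.Perm (Fin N)) := by exact_mod_cast Fintype.card_pos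
  have hc0 : 0 ≤ c := by rw [hc]; positivity
  have hcc : c ^ 2 * (Fintype.card (Equiv.Perm (Fin N)) : ℝ) = c := by
    rw [hc, sq, mul_assoc, inv_mul_cancel₀ hcard.ne', mul_one]
  have hβd : Differentiable ℝ β := hβ.differentiable one_ne_zero
  have hsC : ContDiff ℝ 1 fun X => c * ∑ σ : Equiv.Perm (Fin N), β (X ∘ σ) :=
    contDiff_const.mul (ContDiff.sum fun σ _ => contDiff_comp_perm_real hβ σ)
  -- pointwise convexity
  have hpt : ∀ X, gradDot (fun X => c * ∑ σ : Equiv.Perm (Fin N), β (X ∘ σ))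
      (fun X => c * ∑ σ : Equiv.Perm (Fin N), β (X ∘ σ)) X ≤
      c * ∑ σ : Equiv.Perm (Fin N), gradDot β β (X ∘ σ) := by
    intro X
    have hd : ∀ σ ∈ (Finset.univ : Finset (Equiv.Perm (Fin N))),
        DifferentiableAt ℝ (fun Y => β (Y ∘ σ)) X :=
      fun σ _ => (hasFDerivAt_comp_perm σ (hβd _)).differentiableAt
    calc gradDot (fun X => c * ∑ σ : Equiv.Perm (Fin N), β (X ∘ σ))
          (fun X => c * ∑ σ : Equiv.Perm (Fin N), β (X ∘ σ)) X
        = ∑ i, ∑ k, (c * ∑ σ : Equiv.Perm (Fin N), pderiv i k (fun Y => β (Y ∘ σ)) X) ^ 2 := by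
          simp only [gradDot, pderiv_const_mul_sum Finset.univ hd c, sq]
      _ ≤ ∑ i, ∑ k, c * ∑ σ : Equiv.Perm (Fin N), (pderiv i k (fun Y => β (Y ∘ σ)) X) ^ 2 := by
          refine Finset.sum_le_sum fun i _ => Finset.sum_le_sum fun k _ => ?_
          rw [mul_pow]
          calc c ^ 2 * (∑ σ : Equiv.Perm (Fin N), pderiv i k (fun Y => β (Y ∘ σ)) X) ^ 2
              ≤ c ^ 2 * ((Finset.univ : Finset (Equiv.Perm (Fin N))).card *
                  ∑ σ : Equiv.Perm (Fin N), (pderiv i k (fun Y => β (Y ∘ σ)) X) ^ 2) :=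
                mul_le_mul_of_nonneg_left sq_sum_le_card_mul_sum_sq (sq_nonneg c)
            _ = c * ∑ σ : Equiv.Perm (Fin N), (pderiv i k (fun Y => β (Y ∘ σ)) X) ^ 2 := by
                rw [Finset.card_univ, ← mul_assoc, hcc]
      _ = c * ∑ σ : Equiv.Perm (Fin N),
            gradDot (fun Y => β (Y ∘ σ)) (fun Y => β (Y ∘ σ)) X := by
          simp only [gradDot, sq, Finset.mul_sum]
          calc ∑ i, ∑ k, ∑ σ : Equiv.Perm (Fin N),
                c * (pderiv i k (fun Y => β (Y ∘ σ)) X * pderiv i k (fun Y => β (Y ∘ σ)) X)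
              = ∑ i, ∑ σ : Equiv.Perm (Fin N), ∑ k,
                  c * (pderiv i k (fun Y => β (Y ∘ σ)) X * pderiv i k (fun Y => β (Y ∘ σ)) X) :=
                Finset.sum_congr rfl fun i _ => Finset.sum_comm
            _ = _ := Finset.sum_comm
      _ = c * ∑ σ : Equiv.Perm (Fin N), gradDot β β (X ∘ σ) := by
          simp only [gradDot_comp_perm hβd]
  -- integrate
  have hint1 : IntegrableOn (fun X => Θ₀ X ^ 2 *
      gradDot (fun X => c * ∑ σ : Equiv.Perm (Fin N), β (X ∘ σ))
        (fun X => c * ∑ σ : Equiv.Perm (Fin N), β (X ∘ σ)) X) (cellN N L) :=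
    integrableOn_cellN ((hΘc.pow 2).mul (continuous_gradDot hsC hsC)) L
  have hcσ : ∀ σ : Equiv.Perm (Fin N), Continuous fun X : Config N => gradDot β β (X ∘ σ) :=
    fun σ => (continuous_gradDot hβ hβ).comp (continuous_pi fun i => continuous_apply (σ i))
  have hint2 : IntegrableOn (fun X => Θ₀ X ^ 2 * (c * ∑ σ : Equiv.Perm (Fin N), gradDot β β (X ∘ σ)))
      (cellN N L) :=
    integrableOn_cellN ((hΘc.pow 2).mul (continuous_const.mul
      (continuous_finsetSum _ fun σ _ => hcσ σ))) L
  have hint3 : ∀ σ : Equiv.Perm (Fin N),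
      IntegrableOn (fun X => Θ₀ X ^ 2 * gradDot β β (X ∘ σ)) (cellN N L) :=
    fun σ => integrableOn_cellN ((hΘc.pow 2).mul (hcσ σ)) L
  have hterm : ∀ σ : Equiv.Perm (Fin N),
      ∫ X in cellN N L, Θ₀ X ^ 2 * gradDot β β (X ∘ σ) = ∫ X in cellN N L, Θ₀ X ^ 2 * gradDot β β X := by
    intro σ
    have h := setIntegral_cellN_comp_perm L σ (fun X => Θ₀ X ^ 2 * gradDot β β X)
    simp only [hΘsymm] at h
    exact h
  calc ∫ X in cellN N L, Θ₀ X ^ 2 *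
          gradDot (fun X => c * ∑ σ : Equiv.Perm (Fin N), β (X ∘ σ))
            (fun X => c * ∑ σ : Equiv.Perm (Fin N), β (X ∘ σ)) X
      ≤ ∫ X in cellN N L, Θ₀ X ^ 2 * (c * ∑ σ : Equiv.Perm (Fin N), gradDot β β (X ∘ σ)) :=
        setIntegral_mono_on hint1 hint2 (measurableSet_cellN N L)
          fun X _ => mul_le_mul_of_nonneg_left (hpt X) (sq_nonneg _)
    _ = c * ∑ σ : Equiv.Perm (Fin N), ∫ X in cellN N L, Θ₀ X ^ 2 * gradDot β β (X ∘ σ) := by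
        rw [← integral_finsetSum _ fun σ _ => hint3 σ, ← integral_const_mul]
        refine integral_congr_ae (ae_of_all _ fun X => ?_)
        simp only [Finset.mul_sum]
        exact Finset.sum_congr rfl fun σ _ => by ring
    _ = ∫ X in cellN N L, Θ₀ X ^ 2 * gradDot β β X := by
        simp only [hterm, Finset.sum_const, Finset.card_univ, nsmul_eq_mul]
        rw [← mul_assoc, hc, inv_mul_cancel₀ hcard.ne', one_mul]

/-- **Symmetric tests suffice for the `H₋₁` bound.** For symmetric continuous `Θ₀` and `g`, if every
SYMMETRIC periodic test `β` has `2∫Θ₀²βg - ∫Θ₀²|∇β|² ≤ C`, then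
`hMinusOneSqW L Θ₀ g ≤ C`. [folklore] -/
theorem hMinusOneSqW_le_of_symmetric_tests (L : ℝ) {g Θ₀ : Config N → ℝ} {C : ℝ} (hg : Continuous g)
    (hgsymm : ∀ (σ : Equiv.Perm (Fin N)) (X : Config N), g (X ∘ σ) = g X)
    (hΘc : Continuous Θ₀) (hΘsymm : ∀ (σ : Equiv.Perm (Fin N)) (X : Config N), Θ₀ (X ∘ σ) = Θ₀ X)
    (h : ∀ β : Config N → ℝ, IsPeriodicTest L β →
      (∀ (σ : Equiv.Perm (Fin N)) (X : Config N), β (X ∘ σ) = β X) →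
      2 * (∫ X in cellN N L, Θ₀ X ^ 2 * (β X * g X)) - ∫ X in cellN N L, Θ₀ X ^ 2 * gradDot β β X ≤ C) :
    hMinusOneSqW L Θ₀ g ≤ ENNReal.ofReal C := by
  unfold hMinusOneSqW
  refine iSup₂_le fun β hβ => ENNReal.ofReal_le_ofReal ?_
  have h1 := h _ (isPeriodicTest_symmetrise hβ) (symmetrise_comp_perm β)
  have hint : ∀ σ : Equiv.Perm (Fin N),
      IntegrableOn (fun X => Θ₀ X ^ 2 * (β (X ∘ σ) * g X)) (cellN N L) := fun σ =>
    integrableOn_cellN ((hΘc.pow 2).mul ((contDiff_comp_perm_real hβ.1 σ).continuous.mul hg)) L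
  rw [integral_symmetrise_pairing hgsymm hΘsymm hint] at h1
  have h2 := integral_symmetrise_dirichlet_le (L := L) hΘc hΘsymm hβ.1
  have e1 : ∫ X in cellN N L, g X * β X * Θ₀ X ^ 2 = ∫ X in cellN N L, Θ₀ X ^ 2 * (β X * g X) :=
    integral_congr_ae (ae_of_all _ fun X => by ring)
  have e2 : dirichletFormW L Θ₀ β β = ∫ X in cellN N L, Θ₀ X ^ 2 * gradDot β β X := by
    rw [dirichletFormW]
    exact integral_congr_ae (ae_of_all _ fun X => by ring)
  rw [e1, e2]
  linarith

end Symmetrise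

end Summit.AtomisticToContinuum.BoseEinsteinCondensation.Theorems.CorrectorClosure.HealingScaleKacInsertion.ResponseDictionary

end
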